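import Mathlib
import Summits.AnomalousDissipation.AnomalousDissipation.Theses.MarginalStabilityChain
import Literature.Analysis.FluidPDE.DoeringFoiasPowerProofs
import Literature.Analysis.FunctionSpaces.TorusClassicalNSUniqueness
import Literature.Analysis.FunctionSpaces.TorusLerayHelmholtz
import Literature.Analysis.FluidPDE.TurbWave0

/-!
# Crux triage r1-3 (triager 3 of 3), crux stmt-AnomalousDissipation-3005 (`MarginalStabilityChain.ChainThesis`)
# — the two kernel-checked attacks behind TRIAGE-r1-3.md

§A  GALILEAN COSTUME of card `drifting-frozen-states`: `IsRelativeEquilibrium` (copied verbatim from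
    `Cruxes/ChainThesis/Ideate2Sketch.lean`) at speed `c` is EXACTLY the steady system for `U - c e₂`
    (`isRelativeEquilibrium_iff_steady_shift`, no sorry, axioms {propext, Classical.choice, Quot.sound}).
    Hence the card's witness class (patterns drifting along a symmetry direction of `f`) equals the class of
    steady states with free momentum (FrozenK41.SteadyWitness 0219 / CoherentStates.SteadyZerothLaw admit any
    momentum), and with bounded speeds its C⁺ implies 0219 ⟹ CoherentThesis 0218 ⟹ ChainThesis, all filed.

§B  JUNK DOOR in card `cesaro-serrin-moment-eternal`'s typed C⁺ `CesaroSerrinFamily`: its distinguishing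
    clause is a `timeMean` (Bochner interval integral, junk `0` off integrability) of `‖∇u_j‖₂⁴`, so it HOLDS
    with `M = 0` exactly when `t ↦ ‖∇u_j(t)‖₂⁴` is non-integrable — Leray singular times (`≳ ν³/(T*-t)`) and
    rough data — the cases it is meant to exclude.  Model: Cesàro means of `(t-1)⁻¹` and `t⁻¹` are `0`.
    Fix: state the moment as `∫⁻ t in Ioo 0 T, eGradNormSq (u j t) ^ 2 ≤ ENNReal.ofReal (M * T)` (the card's
    own `CesaroSerrinEternal` already uses the `∫⁻ … < ∞` form).
-/

set_option linter.dupNamespace false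

/-! ## §A Galilean costume -/

namespace Summit.AnomalousDissipation.AnomalousDissipation.Cruxes.ChainThesis.Triage3

open Literature.Analysis.FunctionSpaces Literature.Analysis.FunctionSpaces.Torus
open Literature.Analysis.FluidPDE

local notation "𝕋³" => UnitAddTorus (Fin 3)
local notation "E³" => EuclideanSpace ℝ (Fin 3)

/-- Verbatim from Ideate2Sketch.lean (card drifting-frozen-states). -/
def IsRelativeEquilibrium (ν c : ℝ) (f U : 𝕋³ → E³) (P : 𝕋³ → ℝ) : Prop :=
  IsSmooth U ∧ IsSmooth P ∧ IsDivFree U ∧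
    ∀ x, -c • partialDeriv (2 : Fin 3) U x + convect U U x =
      ν • laplacian U x - gradient P x + f x

/-- The unit vector `e₂`. -/
noncomputable def e2 : E³ := EuclideanSpace.single (2 : Fin 3) (1 : ℝ)

theorem convect_sub_const {U : 𝕋³ → E³} (hU : IsSmooth U) (w : E³) (x : 𝕋³) :
    convect (fun y => U y - w) (fun y => U y - w) x = convect U U x - Torus.fderiv U x w := by
  have h1 : IsContDiff 1 U := hU.isContDiff (by simp)
  have hc : IsContDiff 1 (fun _ : 𝕋³ => w) := isContDiff_const w
  have hfd : Torus.fderiv (fun y => U y - w) x = Torus.fderiv U x := by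
    have := Torus.fderiv_sub h1 hc x
    have hz : Torus.fderiv (fun _ : 𝕋³ => w) x = 0 := by
      have h : liftAt (fun _ : 𝕋³ => w) x = fun _ => w := rfl
      simp [Torus.fderiv, h]
    rw [show (fun y => U y - w) = U - (fun _ => w) from rfl, this, hz, sub_zero]
  simp only [Torus.convect, hfd, map_sub]

theorem laplacian_sub_const {U : 𝕋³ → E³} (hU : IsSmooth U) (w : E³) (x : 𝕋³) :
    laplacian (fun y => U y - w) x = laplacian U x := by
  have := Torus.laplacian_sub hU (isSmooth_const w)
  rw [show (fun y => U y - w) = U - (fun _ => w) from rfl, this, Pi.sub_apply,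
    laplacian_fun_const, sub_zero]

theorem isDivFree_sub_const_iff {U : 𝕋³ → E³} (hU : IsSmooth U) (w : E³) :
    IsDivFree (fun y => U y - w) ↔ IsDivFree U := by
  have h1 : IsContDiff 1 U := hU.isContDiff (by simp)
  have hc : IsContDiff 1 (fun _ : 𝕋³ => w) := isContDiff_const w
  have key : ∀ x, divergence (fun y => U y - w) x = divergence U x := fun x => by
    rw [show (fun y => U y - w) = U - (fun _ => w) from rfl, divergence_sub h1 hc x,
      isDivFree_fun_const w x, sub_zero]
  exact ⟨fun h x => (key x) ▸ h x, fun h x => (key x).symm ▸ h x⟩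

/-- **Galilean costume.** A relative equilibrium of speed `c` is exactly a steady state shifted by
the constant `c e₂`; conversely. (Pure torus calculus; the force never moves because the statement
quantifies the SAME `f` on both sides — legitimate precisely when `f` is `e₂`-invariant, which is
the card's setting, but the algebraic identity below does not even need that.) -/
theorem isRelativeEquilibrium_iff_steady_shift (ν c : ℝ) (f U : 𝕋³ → E³) (P : 𝕋³ → ℝ) :
    IsRelativeEquilibrium ν c f U P ↔ IsRelativeEquilibrium ν 0 f (fun x => U x - c • e2) P := by
  constructor
  · rintro ⟨hU, hP, hdiv, hmom⟩
    refine ⟨hU.sub (isSmooth_const _), hP, (isDivFree_sub_const_iff hU _).2 hdiv, fun x => ?_⟩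
    have h1 : IsContDiff 1 U := hU.isContDiff (by simp)
    rw [convect_sub_const hU, laplacian_sub_const hU, neg_zero, zero_smul, zero_add,
      ContinuousLinearMap.map_smul]
    change Torus.convect U U x - c • Torus.fderiv U x (EuclideanSpace.single (2 : Fin 3) (1 : ℝ)) = _
    rw [← partialDeriv_eq_fderiv_apply h1]
    have := hmom x
    rw [neg_smul] at this
    rw [sub_eq_neg_add]; exact this
  · rintro ⟨hU', hP, hdiv', hmom'⟩
    have hU : IsSmooth U := by
      have h := hU'.add (isSmooth_const (c • e2))
      have hfun : ((fun x => U x - c • e2) + fun _ : 𝕋³ => c • e2) = U := by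
        funext x; simp
      rw [hfun] at h; exact h
    have h1 : IsContDiff 1 U := hU.isContDiff (by simp)
    refine ⟨hU, hP, (isDivFree_sub_const_iff hU _).1 hdiv', fun x => ?_⟩
    have := hmom' x
    rw [convect_sub_const hU, laplacian_sub_const hU, neg_zero, zero_smul, zero_add,
      ContinuousLinearMap.map_smul] at this
    change Torus.convect U U x - c • Torus.fderiv U x (EuclideanSpace.single (2 : Fin 3) (1 : ℝ)) = _
      at this
    rw [← partialDeriv_eq_fderiv_apply h1] at this
    rw [neg_smul, ← sub_eq_neg_add]; exact this

end Summit.AnomalousDissipation.AnomalousDissipation.Cruxes.ChainThesis.Triage3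

/-! ## §B Junk door in `CesaroSerrinFamily` -/

section JunkMoment
open Literature.Analysis.FluidPDE MeasureTheory

example (T : ℝ) (hT : 1 ≤ T) : timeMean (fun t : ℝ => (t - 1)⁻¹) T = 0 := by
  unfold timeMean
  rw [intervalIntegral.integral_undef, mul_zero]
  rw [intervalIntegrable_sub_inv_iff]
  push Not
  refine ⟨by linarith, ?_⟩
  rw [Set.uIcc_of_le (by linarith)]
  exact ⟨by linarith, hT⟩

/-- Same at the data end: `t⁻¹` (rough data at `t = 0`). -/
example (T : ℝ) (hT : 1 ≤ T) : timeMean (fun t : ℝ => t⁻¹) T = 0 := by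
  unfold timeMean
  rw [intervalIntegral.integral_undef, mul_zero]
  rw [intervalIntegrable_inv_iff]
  push Not
  refine ⟨by linarith, ?_⟩
  rw [Set.uIcc_of_le (by linarith)]
  exact ⟨le_rfl, by linarith⟩

end JunkMoment
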